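import Mathlib
import Summits.AnomalousDissipation.AnomalousDissipation.Theorems.SoloBlindRollLatticeEigen

/-!
# The physical-angle dictionary of the ideal leaf chain (solo-blind kernel #188)

Paper `steady-zeroth-law.md` §24.106 (3) / PLAN §107 (c).  Companion to `SoloBlindRollLatticeEigen`: the elementary trigonometric identities that turn the
remaining structure matrices of the chain into local operators in the angle variable.

* `rollEigen_closed` — closed form of the roll eigenfunction numerator: `p_m(ϑ) = 2 sin(mϑ) cos ϑ - 2 m cos(mϑ) sin ϑ`; hence the curvature coupling
  streak → roll (identity on the mode index) reads `Σ σ_m p_m = 2 cos ϑ · S - 2 sin ϑ · S'` with `S = Σ σ_m sin(mϑ)` the conjugate function;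
* `liftUp_symbol` — the lift-up column of roll mode `j` (entries `1/j` at streak `j-1`, `-1/j` at streak `j+1`) is the function
  `(cos((j-1)θ) - cos((j+1)θ))/j = 2 sin θ sin(jθ)/j`;
* `forcing_symbol` — the `r₁`-forcing of the streaks (`√2·(1/√2)` at `s₀`, `-1` at `s₂`, times `iP hx`) is `1 - cos 2θ = 2 sin²θ`, which vanishes to second
  order at the critical points `θ = 0, π` of the Doppler profile `2 cos θ` (the source of the `φ^{-3/2}` decay of the streak read-out);
* `streak_moment_weight` — `cos θ · (sin θ ^ 2 / cos θ) = sin θ ^ 2` off the critical layer (`cos θ ≠ 0`): the `cos`-moment of the bulk frame `-(hx/h) sin²θ/cos θ`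
  is layer-free.
-/

namespace Summit.AnomalousDissipation.AnomalousDissipation.Theorems

open Real

/-- Closed form `p_m(ϑ) = 2 sin(mϑ) cos ϑ - 2 m cos(mϑ) sin ϑ`. -/
theorem rollEigen_closed (m ϑ : ℝ) : rollEigen m ϑ = 2 * sin (m * ϑ) * cos ϑ - 2 * m * cos (m * ϑ) * sin ϑ := by
  simp only [rollEigen]
  rw [show (m - 1) * ϑ = m * ϑ - ϑ by ring, show (m + 1) * ϑ = m * ϑ + ϑ by ring, sin_sub, sin_add]; ring

/-- Lift-up symbol: `cos((j-1)θ) - cos((j+1)θ) = 2 sin θ sin(jθ)`. -/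
theorem liftUp_symbol (j θ : ℝ) : cos ((j - 1) * θ) - cos ((j + 1) * θ) = 2 * sin θ * sin (j * θ) := by
  rw [show (j - 1) * θ = j * θ - θ by ring, show (j + 1) * θ = j * θ + θ by ring, cos_sub, cos_add]; ring

/-- Forcing symbol: `1 - cos 2θ = 2 sin²θ`. -/
theorem forcing_symbol (θ : ℝ) : 1 - cos (2 * θ) = 2 * sin θ ^ 2 := by
  rw [cos_two_mul, cos_sq']; ring

/-- The forcing symbol vanishes to second order at the critical points: `2 sin²θ ≤ 2 θ²`. -/
theorem forcing_symbol_le_sq (θ : ℝ) : 2 * sin θ ^ 2 ≤ 2 * θ ^ 2 := by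
  have h := Real.abs_sin_le_abs (x := θ)  -- |sin θ| ≤ |θ|
  have : sin θ ^ 2 ≤ θ ^ 2 := by
    rw [← sq_abs (sin θ), ← sq_abs θ]; exact pow_le_pow_left₀ (abs_nonneg _) h 2
  linarith

/-- The `cos`-moment weight removes the critical-layer singularity of the bulk frame: `cos θ · (sin²θ / cos θ) = sin²θ` for `cos θ ≠ 0`. -/
theorem streak_moment_weight (θ : ℝ) (h : cos θ ≠ 0) : cos θ * (sin θ ^ 2 / cos θ) = sin θ ^ 2 := by
  field_simp

end Summit.AnomalousDissipation.AnomalousDissipation.Theorems
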